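import Summits.ResolutionOfSingularities.ResolutionOfSingularities.Theorems.ValuativeLuAlphaPTorsorDiscreteAllDim
import Summits.ResolutionOfSingularities.ResolutionOfSingularities.Theorems.FrobeniusClosingSteerCore4CompositeRankConcl
import Literature.AlgebraicGeometry.Resolution.LocalUniformizationClosedPoints
import Literature.AlgebraicGeometry.Resolution.AffineDomainDimension
import Mathlib.RingTheory.KrullDimension.NonZeroDivisors

/-!
# Steer core, stub S0 `CompositeRankSS`: the (b)-BRIDGE — composite rank along a DISCRETE coarsening reduces to zero-dimensional local uniformization below the transcendence degree

OURS (campaign res-hironaka, rung L, slot W4.1, crux `Steer` stmt-ResolutionOfSingularities-16345, line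
`switching_dichotomy` / res-L0-w41-strat-1's `ss-monomial-cycles` §F, registered frontier stub S0 `CompositeRankSS`; prover
seat res-type-028 gen 8, per res-L0-w41-plan-1's WORD 2026-08-27T06:50:33Z «(H2) the (b)-BRIDGE»; replaces the role of no
printed item; NOT a statement of the manuscript under review; AI-produced, weaker than expert review).
`--supports stmt-ResolutionOfSingularities-16345 --as helper`. Theses-free, definition-free.

THE BRIDGE `concl_of_discreteCoarsening_of_luZeroDimBelow`: for the torsor datum of `Steer` (perfect ground field `k` of
characteristic `p`; `A₀ ⊆ O` finitely generated and regular at the centre of `O`; `t ^ p ∈ A₀`; `Frac A₀[t] = K`;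
`trdeg_k K = n`; `O` ZERO-DIMENSIONAL over `k`) along a valuation ring `O` with a coarsening `O ≤ O₁ ≠ K` which is DISCRETE
of rank one, the conclusion `Concl O A₀ t` (a finitely generated model `A ⊇ A₀ ∋ t` of `K` inside `O`, regular at the centre
of `O`) follows from ONE hypothesis, spelled out (no new definition):

  `hLU` («LUZeroDimBelow n», res-L0-w41-tri-1's fix (b)): every finitely generated `k`-model `B` of a field `κ ⊇ k` of
  transcendence degree `< n`, along a ZERO-DIMENSIONAL valuation ring `O' ⊇ k` of `κ`, is dominated by a finitely generated
  model `B' ⊆ O'` regular at the centre of `O'`.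

Route (Novacoski–Spivakovsky 2014, §§2–3, all steps in the tree): the `ν₁`-side model is the tree's
`luAlphaPTorsor_of_discrete` (torsor local uniformization along a DISCRETE rank-one valuation ring, every transcendence
degree, every ground field) applied to `(A₀, t)` along `O₁` — `A₀` is regular at the centre of `O₁` by Serre's
localisation theorem (`isRegularLocalRing_centre_of_le`); `novacoskiSpivakovsky2014_cor214` moves it inside `O`; on the
residue side the valuation ring `O / 𝔪_{O₁}` (restricted to the residue field `κ = Frac φ(A)` of the model) is again
zero-dimensional over `k` (`zeroDim_comap_residueValuationSubring`) and `trdeg_k κ < n` (`trdeg_residueField_lt`: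
`φ(A) ≅ A / P` with `P ≠ 0` the centre of `O₁`), so `hLU` supplies the input `h₂` of `novacoskiSpivakovsky2014_cor217`,
and `novacoskiSpivakovsky2014_step` concludes.

WHAT THIS PRICES (bookkeeping for the holder; nothing registered here): inside the skeleton, S0 `CompositeRankSS`
(composite rank at `n ≥ 5` along a strongly switching datum) closes from this bridge plus TWO named inputs —
(ν₂) «LUZeroDimBelow n» as above, and (ν₁) «the rank-one coarsening of a strongly switching valuation ring of rank `≥ 2`
is DISCRETE» (Heinzer–Olberding–Toeniskoetter, arXiv:1505.06445, Thm. 8.1 with Lemma 8.6: a Shannon extension which is a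
valuation ring of dimension `> 1` has dimension `2` and its height-one localisation is an essential prime divisor
`(R_i)_{P_i}`; not in the tree). Neither `StronglySwitching`, nor `p ≠ 2`, nor `n ≠ 4`, nor the remaining conjuncts of
the line's `CoreDatum` are used by the bridge itself.
-/

noncomputable section

-- single-problem summit: the doubled namespace component `ResolutionOfSingularities` is forced
set_option linter.dupNamespace false

open scoped BigOperators Classical

namespace Summit.ResolutionOfSingularities.ResolutionOfSingularities.Theorems.SteerRankThinness

section LUBelow

open IsLocalRing Algebra
open Literature.AlgebraicGeometry.Resolution
open Summit.ResolutionOfSingularities.ResolutionOfSingularities.Theorems.PfaffLine (luAlphaPTorsor_of_discrete)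

variable {k K : Type} [Field k] [Field K] [Algebra k K]

/-! ## Residue side, input 1: zero-dimensionality descends to the residue valuation ring -/

/-- **`O / 𝔪_{O₁}` is zero-dimensional over `k` when `O` is.** For a coarsening `O ≤ O₁` of valuation rings of `K ⊇ k`
with `O` zero-dimensional over `k` (every element of `O` is a root modulo `𝔪_O` of a non-zero polynomial over `k`), a
subfield `κ` of the residue field `κ(O₁)` (`ι : κ → κ(O₁)` compatible with the `k`-structures) and the restriction
`O' = (O / 𝔪_{O₁}) ∩ κ` of the residue valuation ring: every element of `O'` is a root modulo `𝔪_{O'}` of a non-zero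
polynomial over `k` — lift to `O`, take the polynomial there, and read the value through
`valuation_lt_one_iff_residue` / `valuation_comap_lt_one_iff`. [folklore] -/
theorem zeroDim_comap_residueValuationSubring (O O₁ : ValuationSubring K) (hO : O ≤ O₁)
    (hk : ∀ c : k, algebraMap k K c ∈ O)
    (hZ : ∀ x : K, x ∈ O → ∃ f : Polynomial k, f ≠ 0 ∧ Polynomial.aeval x f ∈ O.nonunits)
    (κ : Type) [Field κ] [Algebra k κ] (ι : κ →+* ResidueField O₁)
    (hι : ∀ c : k, ι (algebraMap k κ c) = residue O₁ ⟨algebraMap k K c, hO (hk c)⟩) :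
    ∀ x : κ, x ∈ (residueValuationSubring O O₁ hO).comap ι →
      ∃ f : Polynomial k, f ≠ 0 ∧
        Polynomial.aeval x f ∈ ((residueValuationSubring O O₁ hO).comap ι).nonunits := by
  classical
  intro x hx
  set O₂ := residueValuationSubring O O₁ hO with hO₂def
  have hx' : ι x ∈ O₂ := ValuationSubring.mem_comap.mp hx
  obtain ⟨a, ha⟩ := (mem_residueValuationSubring_iff O O₁ hO (ι x)).mp hx'
  obtain ⟨f, hf0, hf⟩ := hZ (a : K) a.2
  refine ⟨f, hf0, ?_⟩
  -- the `k`-subalgebra structure on `O`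
  let Ok : Subalgebra k K := { O.toSubring with algebraMap_mem' := hk }
  have hOk₁ : Ok.toSubring ≤ O₁.toSubring := fun z hz => hO hz
  have hfa : Polynomial.aeval (a : K) f ∈ O := by
    have h1 : Polynomial.aeval (a : K) f ∈ Algebra.adjoin k {(a : K)} :=
      Polynomial.aeval_mem_adjoin_singleton k (a : K)
    have h2 : Algebra.adjoin k {(a : K)} ≤ Ok :=
      Algebra.adjoin_le (Set.singleton_subset_iff.mpr (show (a : K) ∈ Ok from a.2))
    exact h2 h1
  -- value of `f(a)` read in `O`, then in `O₂`
  have hval : O.valuation (Polynomial.aeval (a : K) f) < 1 :=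
    (ValuationSubring.mem_nonunits_iff _).mp hf
  rw [valuation_lt_one_iff_residue O O₁ hO _ hfa] at hval
  -- the residue of `f(a)` is `ι (f(x))`
  let r : Ok →+* ResidueField O₁ := (residue O₁).comp (Subring.inclusion hOk₁)
  have hr_alg : ∀ c : k, r (algebraMap k Ok c) = ι (algebraMap k κ c) := by
    intro c
    rw [hι]
    rfl
  have hra : r ⟨(a : K), a.2⟩ = ι x := by
    rw [← ha]
    rfl
  have hkey : residue O₁ ⟨Polynomial.aeval (a : K) f, hO hfa⟩ = ι (Polynomial.aeval x f) := by
    have h1 : residue O₁ ⟨Polynomial.aeval (a : K) f, hO hfa⟩ =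
        r (Polynomial.aeval (⟨(a : K), a.2⟩ : Ok) f) := by
      have hcoe : ((Polynomial.aeval (⟨(a : K), a.2⟩ : Ok) f : Ok) : K) = Polynomial.aeval (a : K) f :=
        (Subalgebra.aeval_coe Ok ⟨(a : K), a.2⟩ f).symm
      change residue O₁ ⟨Polynomial.aeval (a : K) f, hO hfa⟩ =
        residue O₁ (Subring.inclusion hOk₁ (Polynomial.aeval (⟨(a : K), a.2⟩ : Ok) f))
      congr 1
      exact Subtype.ext hcoe.symm
    rw [h1, Polynomial.aeval_def, Polynomial.hom_eval₂, hra, Polynomial.aeval_def, Polynomial.hom_eval₂]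
    congr 1
    ext c
    simp only [RingHom.coe_comp, Function.comp_apply]
    exact hr_alg c
  rw [hkey] at hval
  exact (ValuationSubring.mem_nonunits_iff _).mpr ((valuation_comap_lt_one_iff O₂ ι _).mpr hval)

/-! ## Residue side, input 2: the residue field of the model has smaller transcendence degree -/

/-- **`trdeg_k Frac (A / P) < trdeg_k Frac A` for the centre `P ≠ 0` of a proper valuation ring.** For a finitely
generated `k`-model `A ⊆ O₁ ≠ K` of `K` (`Frac A = K`, `trdeg_k K = n`) and the residue map `φ : A → κ ⊆ κ(O₁)` with
`Frac φ(A) = κ`: `trdeg_k κ < n`. Indeed `φ(A) ≅ A / P` with `P = 𝔪_{O₁} ∩ A ≠ 0` (as `O₁ ≠ K`), and for a non-zero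
`r ∈ P`: `dim A/P + 1 ≤ dim A/(r) + 1 ≤ dim A = n` (`ringKrullDim_quotient_succ_le_of_nonZeroDivisor`), while
`dim = trdeg` for affine domains. [cite: Matsumura1987, Thm. 5.6] [folklore] -/
theorem trdeg_residueField_lt (O₁ : ValuationSubring K) (hO₁ : O₁ ≠ ⊤)
    (A : Subalgebra k K) (hA₁ : A.toSubring ≤ O₁.toSubring) (hAfg : A.FG) [IsFractionRing A K]
    {n : ℕ} (htr : Algebra.trdeg k K = n)
    (κ : Type) [Field κ] [Algebra k κ] (ι : κ →+* ResidueField O₁) (φ : A →ₐ[k] κ)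
    (hφ : ∀ a : A, ι (φ a) = residue O₁ ⟨(a : K), hA₁ a.2⟩) (hfr : IsFractionRing φ.range κ) :
    Algebra.trdeg k κ < (n : Cardinal) := by
  classical
  haveI : IsNoetherianRing A := isNoetherianRing_of_fg hAfg
  haveI : Algebra.FiniteType k A := (Subalgebra.fg_iff_finiteType _).mp hAfg
  have hAO₁ : ∀ z : A, (z : K) ∈ O₁ := fun z => hA₁ z.2
  let P : Ideal A := (maximalIdeal O₁).comap (Subring.inclusion hA₁)
  haveI : P.IsPrime := Ideal.IsPrime.comap _
  have hP : ∀ z : A, z ∈ P ↔ O₁.valuation (z : K) < 1 := fun z => by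
    rw [Ideal.mem_comap, ValuationSubring.valuation_lt_one_iff]; rfl
  -- `P ≠ 0`
  have hPbot : P ≠ ⊥ := by
    intro hP0
    apply hO₁
    ext z
    simp only [ValuationSubring.mem_top, iff_true]
    obtain ⟨a, b, hb, rfl⟩ := IsFractionRing.div_surjective (A := A) z
    have hb0 : b ≠ 0 := nonZeroDivisors.ne_zero hb
    have hbP : b ∉ P := by rw [hP0]; exact hb0
    have hb1 : O₁.valuation (b : K) = 1 :=
      le_antisymm ((O₁.valuation_le_one_iff _).mpr (hAO₁ b))
        (not_lt.mp fun hlt' => hbP ((hP b).mpr hlt'))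
    change (a : K) / (b : K) ∈ O₁
    rw [div_eq_mul_inv]
    refine mul_mem (hAO₁ a) ?_
    rw [← O₁.valuation_le_one_iff, map_inv₀, hb1, inv_one]
  obtain ⟨r, hrP, hr0⟩ := Submodule.exists_mem_ne_zero_of_ne_bot hPbot
  -- the model `B₀ = φ(A) ≅ A / P` of `κ`
  let B₀ : Subalgebra k κ := φ.range
  have hB₀fg : B₀.FG := by
    have h := ((Subalgebra.fg_top A).mpr hAfg).map φ
    rwa [Algebra.map_top] at h
  haveI : Algebra.FiniteType k B₀ := (Subalgebra.fg_iff_finiteType _).mp hB₀fg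
  haveI : IsFractionRing B₀ κ := hfr
  let ψ : A →ₐ[k] B₀ := φ.rangeRestrict
  have hψ : Function.Surjective ψ := AlgHom.rangeRestrict_surjective φ
  have hψval : ∀ a : A, ((ψ a : B₀) : κ) = φ a := fun a => rfl
  have hker : RingHom.ker ψ.toRingHom = P := by
    ext a
    rw [RingHom.mem_ker, hP]
    change ψ a = 0 ↔ _
    rw [Subtype.ext_iff, hψval, ZeroMemClass.coe_zero, ← map_eq_zero_iff ι ι.injective, hφ,
      residue_eq_zero_iff, ValuationSubring.valuation_lt_one_iff]
  have hψ' : Function.Surjective ψ.toRingHom := hψ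
  let e : (A ⧸ P) ≃+* B₀ :=
    (Ideal.quotEquivOfEq hker.symm).trans (RingHom.quotientKerEquivOfSurjective hψ')
  -- dimensions
  obtain ⟨m, hmdim, hmtr⟩ := exists_ringKrullDim_eq_and_trdeg_eq k B₀
  obtain ⟨n', hn'dim, hn'tr⟩ := exists_ringKrullDim_eq_and_trdeg_eq k A
  have hnn' : n' = n := by
    have h := htr
    rw [trdeg_eq_trdeg_of_isFractionRing A, hn'tr] at h
    exact_mod_cast h
  subst hnn'
  have hκ : Algebra.trdeg k κ = m := by rw [trdeg_eq_trdeg_of_isFractionRing B₀, hmtr]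
  have hquot : ringKrullDim (A ⧸ P) = m := by
    rw [ringKrullDim_eq_of_ringEquiv e]; exact hmdim
  have hrnzd : (r : A) ∈ nonZeroDivisors A := mem_nonZeroDivisors_of_ne_zero hr0
  have h1 : ringKrullDim (A ⧸ Ideal.span {r}) + 1 ≤ ringKrullDim A :=
    ringKrullDim_quotient_succ_le_of_nonZeroDivisor hrnzd
  have h2 : ringKrullDim (A ⧸ P) ≤ ringKrullDim (A ⧸ Ideal.span {r}) :=
    ringKrullDim_le_of_surjective (Ideal.Quotient.factor ((Ideal.span_singleton_le_iff_mem _).mpr hrP))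
      (Ideal.Quotient.factor_surjective _)
  have h3 : ringKrullDim (A ⧸ P) + 1 ≤ ringKrullDim A :=
    (add_le_add h2 (le_refl (1 : WithBot ℕ∞))).trans h1
  rw [hquot, hn'dim] at h3
  have h4 : m + 1 ≤ n' := by
    have h3' : ((m + 1 : ℕ) : WithBot ℕ∞) ≤ ((n' : ℕ) : WithBot ℕ∞) := by exact_mod_cast h3
    exact_mod_cast h3'
  rw [hκ]
  exact_mod_cast (by omega : m < n')

/-! ## The bridge -/

/-- **S0's (b)-BRIDGE: composite rank along a DISCRETE coarsening ⇐ zero-dimensional local uniformization below the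
transcendence degree.** For the torsor datum of `Steer` — `k` perfect of characteristic `p`, `K ⊇ k`, `O` a valuation
ring of `K` ZERO-DIMENSIONAL over `k`, `A₀ ⊆ O` finitely generated and regular at the centre of `O`, `t ^ p ∈ A₀`,
`Frac A₀[t] = K`, `trdeg_k K = n` — and a coarsening `O ≤ O₁ ≠ K` which is DISCRETE of rank one: if every finitely
generated model of every field `κ ⊇ k` of transcendence degree `< n` along a zero-dimensional valuation ring of `κ` is
dominated by a finitely generated model regular at the centre («LUZeroDimBelow n», hypothesis `hLU`, spelled out), then
some finitely generated `A ⊇ A₀ ∋ t` inside `O` with `Frac A = K` is regular at the centre of `O`.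
Proof: `luAlphaPTorsor_of_discrete` along `O₁` (regularity of `A₀` at the centre of `O₁` by
`isRegularLocalRing_centre_of_le`) ⇒ `novacoskiSpivakovsky2014_cor214` ⇒ (`zeroDim_comap_residueValuationSubring`,
`trdeg_residueField_lt`, `hLU`) the input `h₂` of `novacoskiSpivakovsky2014_cor217` ⇒ `novacoskiSpivakovsky2014_step`.
[cite: NovacoskiSpivakovsky2014, §3.1] -/
theorem concl_of_discreteCoarsening_of_luZeroDimBelow (p : ℕ) (hp : p.Prime) [CharP k p] [PerfectField k]
    {n : ℕ} (htr : Algebra.trdeg k K = n)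
    (O O₁ : ValuationSubring K) (hO : O ≤ O₁) (hO₁ : O₁ ≠ ⊤)
    (hdisc : ∃ π : K, π ≠ 0 ∧ O₁.valuation π < 1 ∧
      ∀ z : K, z ≠ 0 → ∃ m : ℤ, O₁.valuation z = O₁.valuation π ^ m)
    (hZ : ∀ x : K, x ∈ O → ∃ f : Polynomial k, f ≠ 0 ∧ Polynomial.aeval x f ∈ O.nonunits)
    (A₀ : Subalgebra k K) (h₀ : A₀.toSubring ≤ O.toSubring) (t : K) (hfg : A₀.FG) (htp : t ^ p ∈ A₀)
    (hfr : IsFractionRing (Algebra.adjoin k (insert t (A₀ : Set K))) K)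
    (hreg : IsRegularLocalRing (Localization.AtPrime
      (Ideal.comap (Subring.inclusion h₀) (maximalIdeal O))))
    (hLU : ∀ (κ : Type) [Field κ] [Algebra k κ] (O' : ValuationSubring κ),
      (∀ c : k, algebraMap k κ c ∈ O') →
      (∀ x : κ, x ∈ O' → ∃ f : Polynomial k, f ≠ 0 ∧ Polynomial.aeval x f ∈ O'.nonunits) →
      Algebra.trdeg k κ < (n : Cardinal) →
      ∀ (B : Subalgebra k κ) (hB : B.toSubring ≤ O'.toSubring), B.FG → IsFractionRing B κ →
        ∃ (B' : Subalgebra k κ) (hB' : B'.toSubring ≤ O'.toSubring), B ≤ B' ∧ B'.FG ∧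
          IsRegularLocalRing (Localization.AtPrime
            ((maximalIdeal O').comap (Subring.inclusion hB')))) :
    Concl O A₀ t := by
  classical
  have hk : ∀ c : k, algebraMap k K c ∈ O := fun c => h₀ (A₀.algebraMap_mem c)
  have h₀₁ : A₀.toSubring ≤ O₁.toSubring := fun z hz => hO (h₀ hz)
  -- (ν₁) `A₀` is regular at the centre of the coarsening `O₁` (Serre), so torsor LU along the DISCRETE `O₁` applies
  have hreg₁ : IsRegularLocalRing (Localization.AtPrime
      (Ideal.comap (Subring.inclusion h₀₁) (maximalIdeal O₁))) :=
    isRegularLocalRing_centre_of_le A₀ hO h₀ h₀₁ hreg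
  obtain ⟨A₁, hA₁, hA₀A₁, htA₁, hA₁fg, -, hA₁reg⟩ :=
    luAlphaPTorsor_of_discrete p hp k K O₁ A₀ h₀₁ t hfg htp hfr hreg₁ hdisc
  -- the model `R = A₀[t] ⊆ O`
  have htO : t ∈ O := by
    have h1 : O.valuation (t ^ p) ≤ 1 := (O.valuation_le_one_iff _).mpr (h₀ htp)
    rw [map_pow] at h1
    exact (O.valuation_le_one_iff t).mp ((pow_le_one_iff_of_nonneg zero_le hp.ne_zero).mp h1)
  set R : Subalgebra k K := Algebra.adjoin k (insert t (A₀ : Set K)) with hRdef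
  have hA₀R : A₀ ≤ R := fun z hz => Algebra.subset_adjoin (Set.mem_insert_of_mem t hz)
  have htR : t ∈ R := Algebra.subset_adjoin (Set.mem_insert t _)
  have hRfg : R.FG := by
    obtain ⟨s, hs⟩ := hfg
    refine ⟨insert t s, ?_⟩
    rw [hRdef, ← hs, Finset.coe_insert, Algebra.adjoin_insert_adjoin]
  have hRO : R.toSubring ≤ O.toSubring := by
    have : R ≤ ({ O.toSubring with algebraMap_mem' := hk } : Subalgebra k K) :=
      Algebra.adjoin_le (Set.insert_subset_iff.mpr ⟨htO, fun z hz => h₀ hz⟩)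
    exact fun z hz => this hz
  haveI hRfrac : IsFractionRing R K := hfr
  have hRA₁ : R ≤ A₁ := Algebra.adjoin_le (Set.insert_subset_iff.mpr ⟨htA₁, fun z hz => hA₀A₁ hz⟩)
  -- Cor. 2.14: a model inside `O` regular at the centre of `ν₁`
  obtain ⟨A, hA, hRA, hAfg, hregPA⟩ :=
    novacoskiSpivakovsky2014_cor214 O O₁ hO R hRfg hRfrac hRO ⟨A₁, hA₁, hRA₁, hA₁fg, hA₁reg⟩
  haveI hAfrac : IsFractionRing A K := isFractionRing_subalgebra_of_le R A hRA
  have hAO₁ : A.toSubring ≤ O₁.toSubring := hA.trans hO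
  -- (ν₂) Cor. 2.17's input from zero-dimensional LU below `n`
  have h₂ : ∀ (κ : Type) [Field κ] [Algebra k κ] (ι : κ →+* ResidueField O₁) (φ : A →ₐ[k] κ),
      (∀ a : A, ι (φ a) = residue O₁ ⟨(a : K), hAO₁ a.2⟩) →
      IsFractionRing φ.range κ →
      ∃ (B : Subalgebra k κ)
        (hB : B.toSubring ≤ ((residueValuationSubring O O₁ hO).comap ι).toSubring),
        φ.range ≤ B ∧ B.FG ∧
        IsRegularLocalRing (Localization.AtPrime
          ((maximalIdeal ((residueValuationSubring O O₁ hO).comap ι)).comap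
            (Subring.inclusion hB))) := by
    intro κ _ _ ι φ hφ hfrB
    set O₂' := (residueValuationSubring O O₁ hO).comap ι with hO₂'def
    have hι : ∀ c : k, ι (algebraMap k κ c) = residue O₁ ⟨algebraMap k K c, hO (hk c)⟩ := by
      intro c
      have h := hφ (algebraMap k A c)
      rw [φ.commutes] at h
      rw [h]
      rfl
    let B₀ : Subalgebra k κ := φ.range
    have hB₀fg : B₀.FG := by
      have h := ((Subalgebra.fg_top A).mpr hAfg).map φ
      rwa [Algebra.map_top] at h
    have hB₀O : B₀.toSubring ≤ O₂'.toSubring := by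
      intro z hz
      obtain ⟨a, rfl⟩ := (AlgHom.mem_range φ).mp (show z ∈ φ.range from hz)
      change φ a ∈ (residueValuationSubring O O₁ hO).comap ι
      rw [ValuationSubring.mem_comap, hφ]
      exact (residue_mem_residueValuationSubring_iff O O₁ hO _).mpr (hA a.2)
    have hk' : ∀ c : k, algebraMap k κ c ∈ O₂' := fun c => hB₀O (B₀.algebraMap_mem c)
    have hZ' := zeroDim_comap_residueValuationSubring O O₁ hO hk hZ κ ι hι
    have htr' : Algebra.trdeg k κ < (n : Cardinal) :=
      trdeg_residueField_lt O₁ hO₁ A hAO₁ hAfg htr κ ι φ hφ hfrB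
    exact hLU κ O₂' hk' hZ' htr' B₀ hB₀O hB₀fg hfrB
  obtain ⟨A₂, hA₂, hAA₂, hA₂fg, hregP₂, hregQ₂⟩ :=
    novacoskiSpivakovsky2014_cor217 O O₁ hO A hA hAfg hAfrac hregPA h₂
  -- §3.1, final step
  haveI hA₂frac : IsFractionRing A₂ K := isFractionRing_subalgebra_of_le A A₂ hAA₂
  obtain ⟨A₃, hA₃, hA₂₃, hA₃fg, hreg₃⟩ :=
    novacoskiSpivakovsky2014_step O O₁ hO A₂ hA₂ hA₂fg hA₂frac hregP₂ hregQ₂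
  exact ⟨A₃, hA₃, hA₀R.trans (hRA.trans (hAA₂.trans hA₂₃)), hA₂₃ (hAA₂ (hRA htR)), hA₃fg,
    isFractionRing_subalgebra_of_le A₂ A₃ hA₂₃, hreg₃⟩

/-- **The same with `HasProperCoarsening`-style packaging** (how the skeleton consumes it): if SOME proper coarsening
`O < O₁ < K` of the zero-dimensional `O` is discrete of rank one, zero-dimensional local uniformization below `n` gives
`Concl O A₀ t` for the torsor datum. [cite: NovacoskiSpivakovsky2014, §3.1] -/
theorem concl_of_exists_discreteCoarsening_of_luZeroDimBelow (p : ℕ) (hp : p.Prime) [CharP k p] [PerfectField k]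
    {n : ℕ} (htr : Algebra.trdeg k K = n) (O : ValuationSubring K)
    (hdisc : ∃ O₁ : ValuationSubring K, O ≤ O₁ ∧ O ≠ O₁ ∧ O₁ ≠ ⊤ ∧
      ∃ π : K, π ≠ 0 ∧ O₁.valuation π < 1 ∧ ∀ z : K, z ≠ 0 → ∃ m : ℤ, O₁.valuation z = O₁.valuation π ^ m)
    (hZ : ∀ x : K, x ∈ O → ∃ f : Polynomial k, f ≠ 0 ∧ Polynomial.aeval x f ∈ O.nonunits)
    (A₀ : Subalgebra k K) (h₀ : A₀.toSubring ≤ O.toSubring) (t : K) (hfg : A₀.FG) (htp : t ^ p ∈ A₀)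
    (hfr : IsFractionRing (Algebra.adjoin k (insert t (A₀ : Set K))) K)
    (hreg : IsRegularLocalRing (Localization.AtPrime
      (Ideal.comap (Subring.inclusion h₀) (maximalIdeal O))))
    (hLU : ∀ (κ : Type) [Field κ] [Algebra k κ] (O' : ValuationSubring κ),
      (∀ c : k, algebraMap k κ c ∈ O') →
      (∀ x : κ, x ∈ O' → ∃ f : Polynomial k, f ≠ 0 ∧ Polynomial.aeval x f ∈ O'.nonunits) →
      Algebra.trdeg k κ < (n : Cardinal) →
      ∀ (B : Subalgebra k κ) (hB : B.toSubring ≤ O'.toSubring), B.FG → IsFractionRing B κ →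
        ∃ (B' : Subalgebra k κ) (hB' : B'.toSubring ≤ O'.toSubring), B ≤ B' ∧ B'.FG ∧
          IsRegularLocalRing (Localization.AtPrime
            ((maximalIdeal O').comap (Subring.inclusion hB')))) :
    Concl O A₀ t := by
  obtain ⟨O₁, hO, -, hO₁, hd⟩ := hdisc
  exact concl_of_discreteCoarsening_of_luZeroDimBelow p hp htr O O₁ hO hO₁ hd hZ A₀ h₀ t hfg htp hfr hreg hLU

end LUBelow

end Summit.ResolutionOfSingularities.ResolutionOfSingularities.Theorems.SteerRankThinness
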